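/-
Copyright (c) 2026 the pub-hodgecm-mathlib formalisation cell (harness21).  Prover seat hodgecm-mathlib-F0P3a-p04 (g19): road «S3-ram» (LEAD F0P3a-plan (g13); junction
pen F0P3a-p01 (g17), J-PACK v2 assembly lemma L3 (skeleton v10, GEN depth-capped form); owner F0P3a-p06 (g15)); 2026-09-02.
-/
import Literature.NumberTheory.Automorphic.UnitaryLatticeTreeEngineRowsPartRamified         -- ★ L3 PART 1 (this seat): label calculus (+ transitively ★ ROW-C∕R∕E, ★ I, ★ ROW-N, ★ charpoly)
import Literature.NumberTheory.Automorphic.UnitaryLatticeTreeNoTransvectionTokenRamified   -- ★ NO-TV (LH4-p01 (g0))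
import Literature.NumberTheory.Automorphic.UnitaryLatticeTreeFixedStarLevelZeroRamified     -- ★ hB «level zero has no fixed grandchildren» (F0P2-p03)
import HarnessLib

/-!
# The lattice graph of a hermitian space — THE ENGINE'S LOCAL-LAW BINDERS FROM THE ★ ROWS (GEN, depth-capped), PART 2: nilpotency under the cap; rows `hodd hB hC hR hE`
# (Kottwitz 1986 §3; Rogawski 1990 §4.9; Bruhat–Tits 1972 §10)

Topic `NumberTheory/Automorphic`; namespace `Literature.NumberTheory.Automorphic.UnitaryLatticeTree`.  THEOREMS ONLY (no definition, no instance, no notation, no named fact,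
no `sorry`); kernel lane `--supports stmt-HodgeConjecture-24833`.  Cell `pub/hodgecm-mathlib` (D-0151), crux H413; road «S3-ram» (Literature seeding, count-neutral); the
(a2) JUNCTION (pen F0P3a-p01 (g17), skeleton v10): assembly lemma **L3 `engineRows_of_rows`** in the GEN (depth-capped) dialect — eigenframe `γ = A·diag(s)·A⁻¹`,
`s 1 = 1`, `|s i − 1| ≤ |ϖ|^D` (equilateral `D = N`, isoceles `D = d₀`), abstract labels `dep rk cl` characterised by `hdep hrk hcl` with cap `B ≥ D`, and every row
stated at a fixed self-dual `v ≠ r₀` with `dep v < D`.  PART 2 (this file): §1 `lev₃_of_lev_of_eigenframe_of_le` — RESIDUAL NILPOTENCY `LEV₃[w](ϖ^(3d+1))` from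
`LEV[w](ϖ^d)` and `d + 1 ≤ D` (★ ROW-N over ★ `charpoly_of_eigenframe`); §2 the rows **`engineRowGen_odd`** (★ I), **`engineRowGen_B`** (depth `0`: no fixed
grandchildren — ★ hB with its `hrk` token paid by ★ NO-TV `not_lev₂_of_not_lev_of_fixed_selfDual`), **`engineRowGen_C`** (★ ROW-C), **`engineRowGen_R`** (★ ROW-R),
**`engineRowGen_E`** (★ ROW-E), each translated by the ★ PART 1 label calculus (`lev_pow_of_le_dep`, `not_lev_pow_of_dep_lt`, `dep_eq_of_lev_of_not_lev`,
`rk_eq_one_iff_of_hrk`, `gc_eq_rowSet`).  The odd rows `hO hP` and the head are PART 3 (`UnitaryLatticeTreeEngineRowsOfRowsRamified`).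

HONEST LABEL: HC_CM is proved only modulo the 2 remaining named inputs (hLiu418 24832, h413 24833) until rung 0 closes; nothing printed is asserted here (bookkeeping over
★ rows); «S3-ram» has no books consequence.

## References
* [Kottwitz1986] R. E. Kottwitz, *Base change for unit elements of Hecke algebras*, Compositio Math. 60 (1986), §3.
* [Rogawski1990] J. D. Rogawski, *Automorphic Representations of Unitary Groups in Three Variables*, Ann. of Math. Stud. 123 (1990), §4.9 pp. 54–56.
* [BruhatTits1972] F. Bruhat, J. Tits, *Groupes réductifs sur un corps local I*, Publ. Math. IHÉS 41 (1972), §10.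
* [Serre1980Trees] J.-P. Serre, *Trees* (1980), Ch. II §1.1.
-/

set_option autoImplicit false

noncomputable section

open scoped Valued WithZero Matrix MatrixGroups
open Polynomial Classical

namespace Literature.NumberTheory.Automorphic.UnitaryLatticeTree

open Literature.NumberTheory.Automorphic Literature.NumberTheory.Automorphic.HermitianLattice

variable {K : Type*} [Field K] [Valued K ℤᵐ⁰] {σ : K →+* K} {ϖ : K}

/-! ## §1 Residual nilpotency under the depth cap -/

/-- **RESIDUAL NILPOTENCY AT EVERY FIXED VERTEX OF DEPTH `d < D`** (★ ROW-N over ★ `charpoly_of_eigenframe`): `γ = A·diag(s)·A⁻¹` with `s 1 = 1`, `|s i − 1| ≤ |ϖ|^D`,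
and `LEV[w](ϖ^d)` with `d + 1 ≤ D` give `LEV₃[w](ϖ^(3d+1))`. [cite: Kottwitz1986, §3] [cite: Rogawski1990, §4.9 pp. 54–56] -/
theorem lev₃_of_lev_of_eigenframe_of_le (hϖ : Valued.v ϖ = WithZero.exp (-1 : ℤ)) {γ : unitaryGroupOfForm σ ((StdForm.antidiagonal 3).over K)} (hγ0 : γ ∈ unitaryInt σ ((StdForm.antidiagonal 3).over K))
    (A : GL (Fin 3) K) (s : Fin 3 → K) (hs1 : s 1 = 1)
    (hγA : ((γ : GL (Fin 3) K) : Matrix (Fin 3) (Fin 3) K) = (A : Matrix (Fin 3) (Fin 3) K) * Matrix.diagonal s * ((A⁻¹ : GL (Fin 3) K) : Matrix (Fin 3) (Fin 3) K))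
    {D : ℕ} (heD : ∀ i, Valued.v (s i - 1) ≤ Valued.v ϖ ^ D)
    (w : {M : Submodule 𝒪[K] (Fin 3 → K) // IsVertex σ ϖ ((StdForm.antidiagonal 3).over K) M}) {d : ℕ} (hdD : d + 1 ≤ D) (hlev : w.1.map ((Matrix.toLin' (((γ : GL (Fin 3) K) : Matrix (Fin 3) (Fin 3) K) - 1)).restrictScalars 𝒪[K]) ≤ scaleLattice (ϖ ^ d) w.1) : w.1.map ((Matrix.toLin' ((((γ : GL (Fin 3) K) : Matrix (Fin 3) (Fin 3) K) - 1) ^ 3)).restrictScalars 𝒪[K]) ≤ scaleLattice (ϖ ^ (3 * d + 1)) w.1 := by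
  have hϖ1 : Valued.v ϖ ≤ 1 := by rw [hϖ, ← WithZero.exp_zero]; exact WithZero.exp_le_exp.2 (by norm_num)
  have hle : Valued.v ϖ ^ D ≤ Valued.v ϖ ^ (d + 1) := pow_le_pow_right_of_le_one' hϖ1 hdD
  exact map_sub_one_pow_three_le_scaleLattice_of_charpoly_antidiagonal hϖ hγ0 (charpoly_of_eigenframe A s hs1 hγA) ((heD 0).trans hle) ((heD 2).trans hle) w hlev

/-! ## §2 The rows `hodd`, `hB`, `hC`, `hR`, `hE` of the engine (GEN dialect) -/

/-- **`hodd`: a fixed self-dual vertex of depth `2 ≤ dep v < D ≤ B` and rank one has ODD depth** (★ I: at even depth `d` with `LEV₂(ϖ^(2d+1))` the level rises to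
`ϖ^(d+1)`, against `¬LEV(ϖ^(d+1))` from `hdep`). [cite: Kottwitz1986, §3] [cite: Rogawski1990, §4.9 pp. 54–56] -/
theorem engineRowGen_odd (hσ : ∀ x, σ (σ x) = x) (hvσ : ∀ a, Valued.v (σ a) = Valued.v a) (hσϖ : σ ϖ = -ϖ)
    (hϖ : Valued.v ϖ = WithZero.exp (-1 : ℤ)) (hres : ∀ x : K, Valued.v x ≤ 1 → Valued.v (σ x - x) < 1) (h2 : Valued.v (2 : K) = 1) [Finite 𝓀[K]]
    {γ : unitaryGroupOfForm σ ((StdForm.antidiagonal 3).over K)} {D : ℕ}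
    (B : ℕ) (dep rk : {M : Submodule 𝒪[K] (Fin 3 → K) // IsVertex σ ϖ ((StdForm.antidiagonal 3).over K) M} → ℕ)
    (hdep : ∀ w : {M : Submodule 𝒪[K] (Fin 3 → K) // IsVertex σ ϖ ((StdForm.antidiagonal 3).over K) M}, latticeGraphIso σ ϖ ((StdForm.antidiagonal 3).over K) γ w = w → ∀ e, e ≤ dep w ↔ e ≤ B ∧ w.1.map ((Matrix.toLin' (((γ : GL (Fin 3) K) : Matrix (Fin 3) (Fin 3) K) - 1)).restrictScalars 𝒪[K]) ≤ scaleLattice (ϖ ^ e) w.1)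
    (hrk : ∀ w : {M : Submodule 𝒪[K] (Fin 3 → K) // IsVertex σ ϖ ((StdForm.antidiagonal 3).over K) M}, rk w = if w.1.map ((Matrix.toLin' ((((γ : GL (Fin 3) K) : Matrix (Fin 3) (Fin 3) K) - 1) ^ 2)).restrictScalars 𝒪[K]) ≤ scaleLattice (ϖ ^ (2 * dep w + 1)) w.1 then 1 else 2)
    (hBD : D ≤ B)
    (v : {M : Submodule 𝒪[K] (Fin 3 → K) // IsVertex σ ϖ ((StdForm.antidiagonal 3).over K) M}) (hvF : v ∈ {v : {M : Submodule 𝒪[K] (Fin 3 → K) // IsVertex σ ϖ ((StdForm.antidiagonal 3).over K) M} | latticeGraphIso σ ϖ ((StdForm.antidiagonal 3).over K) γ v = v}) (hv : IsSelfDualLattice σ ϖ ((StdForm.antidiagonal 3).over K) v.1) (hvD : dep v < D) (_hd2 : 2 ≤ dep v) (hrk1 : rk v = 1) :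
    Odd (dep v) := by
  have hfix : latticeGraphIso σ ϖ ((StdForm.antidiagonal 3).over K) γ v = v := hvF
  by_contra hodd
  rw [Nat.not_odd_iff_even] at hodd
  obtain ⟨u, hu⟩ := exists_latticeGraphIso_root_eq_of_v_two hσ hvσ hϖ h2 v hv (isSelfDualLattice_stdLattice_three_of_v hϖ)
  have hv1 : v.1 = latt ((u : GL (Fin 3) K) : Matrix (Fin 3) (Fin 3) K) := by rw [← hu, latticeGraphIso_apply_val]; rfl
  have hlev := lev_pow_of_le_dep hdep hfix le_rfl
  have hlev₂ := ((rk_eq_one_iff_of_hrk hrk v).1).1 hrk1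
  rw [hv1] at hlev hlev₂
  by_cases h0 : dep v = 0
  · -- depth `0` is even but then `1 ≤ d` fails; use `2 ≤ dep v`
    omega
  have h := map_sub_one_latt_le_scaleLattice_succ_of_even hvσ hσϖ hϖ hres h2 u γ hodd (by omega) hlev hlev₂
  rw [← hv1] at h
  exact not_lev_pow_of_dep_lt hdep hfix (by omega) (Nat.lt_succ_self _) h

/-- **`hB`: a fixed self-dual vertex `v ≠ r₀` of depth `0` (`dep v < D ≤ B`) has NO fixed grandchildren** (★ hB `fixedGrandchildren_eq_empty_of_levelZero`; its
token `¬LEV₂[v](ϖ)` by ★ NO-TV from `¬LEV[v](ϖ)`, its nilpotency token by §1 at `d = 0`). [cite: Kottwitz1986, §3] [cite: BruhatTits1972, §10] -/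
theorem engineRowGen_B (hσ : ∀ x, σ (σ x) = x) (hvσ : ∀ a, Valued.v (σ a) = Valued.v a) (hσϖ : σ ϖ = -ϖ)
    (hϖ : Valued.v ϖ = WithZero.exp (-1 : ℤ)) (hres : ∀ x : K, Valued.v x ≤ 1 → Valued.v (σ x - x) < 1) (h2 : Valued.v (2 : K) = 1) [Finite 𝓀[K]]
    (hT : (latticeGraph σ ϖ ((StdForm.antidiagonal 3).over K)).IsTree)
    {γ : unitaryGroupOfForm σ ((StdForm.antidiagonal 3).over K)} (hγ0 : γ ∈ unitaryInt σ ((StdForm.antidiagonal 3).over K))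
    (A : GL (Fin 3) K) (s : Fin 3 → K) (hs1 : s 1 = 1)
    (hγA : ((γ : GL (Fin 3) K) : Matrix (Fin 3) (Fin 3) K) = (A : Matrix (Fin 3) (Fin 3) K) * Matrix.diagonal s * ((A⁻¹ : GL (Fin 3) K) : Matrix (Fin 3) (Fin 3) K))
    {D : ℕ} (heD : ∀ i, Valued.v (s i - 1) ≤ Valued.v ϖ ^ D)
    (B : ℕ) (dep : {M : Submodule 𝒪[K] (Fin 3 → K) // IsVertex σ ϖ ((StdForm.antidiagonal 3).over K) M} → ℕ)
    (hdep : ∀ w : {M : Submodule 𝒪[K] (Fin 3 → K) // IsVertex σ ϖ ((StdForm.antidiagonal 3).over K) M}, latticeGraphIso σ ϖ ((StdForm.antidiagonal 3).over K) γ w = w → ∀ e, e ≤ dep w ↔ e ≤ B ∧ w.1.map ((Matrix.toLin' (((γ : GL (Fin 3) K) : Matrix (Fin 3) (Fin 3) K) - 1)).restrictScalars 𝒪[K]) ≤ scaleLattice (ϖ ^ e) w.1)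
    (hBD : D ≤ B)
    (GC : {M : Submodule 𝒪[K] (Fin 3 → K) // IsVertex σ ϖ ((StdForm.antidiagonal 3).over K) M} → Set {M : Submodule 𝒪[K] (Fin 3 → K) // IsVertex σ ϖ ((StdForm.antidiagonal 3).over K) M}) (hGC : ∀ v w, w ∈ GC v ↔ ∃ c, ((latticeGraph σ ϖ ((StdForm.antidiagonal 3).over K)).Adj v c ∧ (latticeGraph σ ϖ ((StdForm.antidiagonal 3).over K)).dist ⟨stdLattice K 3, 0, isSelfDualLattice_stdLattice_three_of_v hϖ⟩ c = (latticeGraph σ ϖ ((StdForm.antidiagonal 3).over K)).dist ⟨stdLattice K 3, 0, isSelfDualLattice_stdLattice_three_of_v hϖ⟩ v + 1 ∧ c ∈ {v | latticeGraphIso σ ϖ ((StdForm.antidiagonal 3).over K) γ v = v}) ∧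
      ((latticeGraph σ ϖ ((StdForm.antidiagonal 3).over K)).Adj c w ∧ (latticeGraph σ ϖ ((StdForm.antidiagonal 3).over K)).dist ⟨stdLattice K 3, 0, isSelfDualLattice_stdLattice_three_of_v hϖ⟩ w = (latticeGraph σ ϖ ((StdForm.antidiagonal 3).over K)).dist ⟨stdLattice K 3, 0, isSelfDualLattice_stdLattice_three_of_v hϖ⟩ c + 1 ∧ w ∈ {v | latticeGraphIso σ ϖ ((StdForm.antidiagonal 3).over K) γ v = v}))
    (v : {M : Submodule 𝒪[K] (Fin 3 → K) // IsVertex σ ϖ ((StdForm.antidiagonal 3).over K) M}) (hvF : v ∈ {v : {M : Submodule 𝒪[K] (Fin 3 → K) // IsVertex σ ϖ ((StdForm.antidiagonal 3).over K) M} | latticeGraphIso σ ϖ ((StdForm.antidiagonal 3).over K) γ v = v}) (hv : IsSelfDualLattice σ ϖ ((StdForm.antidiagonal 3).over K) v.1) (hvr : v ≠ ⟨stdLattice K 3, 0, isSelfDualLattice_stdLattice_three_of_v hϖ⟩) (hvD : dep v < D) (hd0 : dep v = 0) :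
    GC v = ∅ := by
  have hfix : latticeGraphIso σ ϖ ((StdForm.antidiagonal 3).over K) γ v = v := hvF
  have hnot := not_lev_pow_of_dep_lt hdep hfix (show 1 ≤ B by omega) (by omega : dep v < 1)
  rw [pow_one] at hnot
  have hrk' := not_lev₂_of_not_lev_of_fixed_selfDual hσ hvσ hσϖ hϖ hres h2 hγ0 hv hfix hnot
  have hnil := lev₃_of_lev_of_eigenframe_of_le hϖ hγ0 A s hs1 hγA heD v (by omega : 0 + 1 ≤ D) (lev_pow_of_le_dep hdep hfix (Nat.zero_le _))
  rw [show 3 * 0 + 1 = 1 from rfl, pow_one] at hnil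
  rw [gc_eq_rowSet hϖ GC hGC v]
  exact fixedGrandchildren_eq_empty_of_levelZero hσ hvσ hσϖ hϖ h2 hT hγ0 hv hvr hfix hrk' hnil

/-- **`hC`: a fixed self-dual vertex of depth `1 < D` and rank `1` has no fixed grandchildren** (★ ROW-C). [cite: Kottwitz1986, §3] [cite: BruhatTits1972, §10] -/
theorem engineRowGen_C (hσ : ∀ x, σ (σ x) = x) (hvσ : ∀ a, Valued.v (σ a) = Valued.v a) (hσϖ : σ ϖ = -ϖ)
    (hϖ : Valued.v ϖ = WithZero.exp (-1 : ℤ)) (hres : ∀ x : K, Valued.v x ≤ 1 → Valued.v (σ x - x) < 1) (h2 : Valued.v (2 : K) = 1) [Finite 𝓀[K]]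
    (hT : (latticeGraph σ ϖ ((StdForm.antidiagonal 3).over K)).IsTree)
    {γ : unitaryGroupOfForm σ ((StdForm.antidiagonal 3).over K)} (hγ0 : γ ∈ unitaryInt σ ((StdForm.antidiagonal 3).over K))
    (A : GL (Fin 3) K) (s : Fin 3 → K) (hs1 : s 1 = 1)
    (hγA : ((γ : GL (Fin 3) K) : Matrix (Fin 3) (Fin 3) K) = (A : Matrix (Fin 3) (Fin 3) K) * Matrix.diagonal s * ((A⁻¹ : GL (Fin 3) K) : Matrix (Fin 3) (Fin 3) K))
    {D : ℕ} (heD : ∀ i, Valued.v (s i - 1) ≤ Valued.v ϖ ^ D)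
    (B : ℕ) (dep rk : {M : Submodule 𝒪[K] (Fin 3 → K) // IsVertex σ ϖ ((StdForm.antidiagonal 3).over K) M} → ℕ)
    (hdep : ∀ w : {M : Submodule 𝒪[K] (Fin 3 → K) // IsVertex σ ϖ ((StdForm.antidiagonal 3).over K) M}, latticeGraphIso σ ϖ ((StdForm.antidiagonal 3).over K) γ w = w → ∀ e, e ≤ dep w ↔ e ≤ B ∧ w.1.map ((Matrix.toLin' (((γ : GL (Fin 3) K) : Matrix (Fin 3) (Fin 3) K) - 1)).restrictScalars 𝒪[K]) ≤ scaleLattice (ϖ ^ e) w.1)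
    (hrk : ∀ w : {M : Submodule 𝒪[K] (Fin 3 → K) // IsVertex σ ϖ ((StdForm.antidiagonal 3).over K) M}, rk w = if w.1.map ((Matrix.toLin' ((((γ : GL (Fin 3) K) : Matrix (Fin 3) (Fin 3) K) - 1) ^ 2)).restrictScalars 𝒪[K]) ≤ scaleLattice (ϖ ^ (2 * dep w + 1)) w.1 then 1 else 2)
    (hBD : D ≤ B)
    (GC : {M : Submodule 𝒪[K] (Fin 3 → K) // IsVertex σ ϖ ((StdForm.antidiagonal 3).over K) M} → Set {M : Submodule 𝒪[K] (Fin 3 → K) // IsVertex σ ϖ ((StdForm.antidiagonal 3).over K) M}) (hGC : ∀ v w, w ∈ GC v ↔ ∃ c, ((latticeGraph σ ϖ ((StdForm.antidiagonal 3).over K)).Adj v c ∧ (latticeGraph σ ϖ ((StdForm.antidiagonal 3).over K)).dist ⟨stdLattice K 3, 0, isSelfDualLattice_stdLattice_three_of_v hϖ⟩ c = (latticeGraph σ ϖ ((StdForm.antidiagonal 3).over K)).dist ⟨stdLattice K 3, 0, isSelfDualLattice_stdLattice_three_of_v hϖ⟩ v + 1 ∧ c ∈ {v | latticeGraphIso σ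 ϖ ((StdForm.antidiagonal 3).over K) γ v = v}) ∧
      ((latticeGraph σ ϖ ((StdForm.antidiagonal 3).over K)).Adj c w ∧ (latticeGraph σ ϖ ((StdForm.antidiagonal 3).over K)).dist ⟨stdLattice K 3, 0, isSelfDualLattice_stdLattice_three_of_v hϖ⟩ w = (latticeGraph σ ϖ ((StdForm.antidiagonal 3).over K)).dist ⟨stdLattice K 3, 0, isSelfDualLattice_stdLattice_three_of_v hϖ⟩ c + 1 ∧ w ∈ {v | latticeGraphIso σ ϖ ((StdForm.antidiagonal 3).over K) γ v = v}))
    (horient : ∀ v : {M : Submodule 𝒪[K] (Fin 3 → K) // IsVertex σ ϖ ((StdForm.antidiagonal 3).over K) M}, IsSelfDualLattice σ ϖ ((StdForm.antidiagonal 3).over K) v.1 → v ≠ ⟨stdLattice K 3, 0, isSelfDualLattice_stdLattice_three_of_v hϖ⟩ → latticeGraphIso σ ϖ ((StdForm.antidiagonal 3).over K) γ v = v → dep v < D →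
      ∃ p g : {M : Submodule 𝒪[K] (Fin 3 → K) // IsVertex σ ϖ ((StdForm.antidiagonal 3).over K) M}, (latticeGraph σ ϖ ((StdForm.antidiagonal 3).over K)).Adj v p ∧ (latticeGraph σ ϖ ((StdForm.antidiagonal 3).over K)).dist ⟨stdLattice K 3, 0, isSelfDualLattice_stdLattice_three_of_v hϖ⟩ p + 1 = (latticeGraph σ ϖ ((StdForm.antidiagonal 3).over K)).dist ⟨stdLattice K 3, 0, isSelfDualLattice_stdLattice_three_of_v hϖ⟩ v ∧ (latticeGraph σ ϖ ((StdForm.antidiagonal 3).over K)).Adj p g ∧ g ≠ v ∧ g.1.map ((Matrix.toLin' (((γ : GL (Fin 3) K) : Matrix (Fin 3) (Fin 3) K) - 1)).restrictScalars 𝒪[K]) ≤ scaleLattice (ϖ ^ dep v) g.1)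
    (v : {M : Submodule 𝒪[K] (Fin 3 → K) // IsVertex σ ϖ ((StdForm.antidiagonal 3).over K) M}) (hvF : v ∈ {v : {M : Submodule 𝒪[K] (Fin 3 → K) // IsVertex σ ϖ ((StdForm.antidiagonal 3).over K) M} | latticeGraphIso σ ϖ ((StdForm.antidiagonal 3).over K) γ v = v}) (hv : IsSelfDualLattice σ ϖ ((StdForm.antidiagonal 3).over K) v.1) (hvr : v ≠ ⟨stdLattice K 3, 0, isSelfDualLattice_stdLattice_three_of_v hϖ⟩) (hvD : dep v < D) (hd1 : dep v = 1) (hrk1 : rk v = 1) :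
    GC v = ∅ := by
  have hfix : latticeGraphIso σ ϖ ((StdForm.antidiagonal 3).over K) γ v = v := hvF
  obtain ⟨p, g, hp, hpin, hg, hgv, hup⟩ := horient v hv hvr hfix hvD
  rw [hd1, pow_one] at hup
  have hlev := lev_pow_of_le_dep hdep hfix (le_of_eq hd1.symm)
  rw [pow_one] at hlev
  have hexact := not_lev_pow_of_dep_lt hdep hfix (show 2 ≤ B by omega) (by omega : dep v < 2)
  have hrk' := ((rk_eq_one_iff_of_hrk hrk v).1).1 hrk1
  rw [hd1] at hrk'
  have hnil := lev₃_of_lev_of_eigenframe_of_le hϖ hγ0 A s hs1 hγA heD v (by omega : 1 + 1 ≤ D) (by rw [pow_one]; exact hlev)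
  rw [gc_eq_rowSet hϖ GC hGC v]
  exact fixedGrandchildren_eq_empty_of_rankOne_depthOne hσ hvσ hσϖ hϖ hres h2 hT hγ0 hv hvr hfix hp hpin hg hgv hup hlev hexact hrk' hnil

/-- **`hR`: a REGULAR fixed self-dual vertex of depth `1 < D` has `q` fixed grandchildren, all of depth `0`** (★ ROW-R). [cite: Kottwitz1986, §3] [cite: BruhatTits1972, §10] -/
theorem engineRowGen_R (hσ : ∀ x, σ (σ x) = x) (hvσ : ∀ a, Valued.v (σ a) = Valued.v a) (hσϖ : σ ϖ = -ϖ)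
    (hϖ : Valued.v ϖ = WithZero.exp (-1 : ℤ)) (hres : ∀ x : K, Valued.v x ≤ 1 → Valued.v (σ x - x) < 1) (h2 : Valued.v (2 : K) = 1) [Finite 𝓀[K]]
    (hT : (latticeGraph σ ϖ ((StdForm.antidiagonal 3).over K)).IsTree)
    {γ : unitaryGroupOfForm σ ((StdForm.antidiagonal 3).over K)} (hγ0 : γ ∈ unitaryInt σ ((StdForm.antidiagonal 3).over K))
    (A : GL (Fin 3) K) (s : Fin 3 → K) (hs1 : s 1 = 1)
    (hγA : ((γ : GL (Fin 3) K) : Matrix (Fin 3) (Fin 3) K) = (A : Matrix (Fin 3) (Fin 3) K) * Matrix.diagonal s * ((A⁻¹ : GL (Fin 3) K) : Matrix (Fin 3) (Fin 3) K))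
    {D : ℕ} (heD : ∀ i, Valued.v (s i - 1) ≤ Valued.v ϖ ^ D)
    (B : ℕ) (dep rk : {M : Submodule 𝒪[K] (Fin 3 → K) // IsVertex σ ϖ ((StdForm.antidiagonal 3).over K) M} → ℕ)
    (hdep : ∀ w : {M : Submodule 𝒪[K] (Fin 3 → K) // IsVertex σ ϖ ((StdForm.antidiagonal 3).over K) M}, latticeGraphIso σ ϖ ((StdForm.antidiagonal 3).over K) γ w = w → ∀ e, e ≤ dep w ↔ e ≤ B ∧ w.1.map ((Matrix.toLin' (((γ : GL (Fin 3) K) : Matrix (Fin 3) (Fin 3) K) - 1)).restrictScalars 𝒪[K]) ≤ scaleLattice (ϖ ^ e) w.1)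
    (hrk : ∀ w : {M : Submodule 𝒪[K] (Fin 3 → K) // IsVertex σ ϖ ((StdForm.antidiagonal 3).over K) M}, rk w = if w.1.map ((Matrix.toLin' ((((γ : GL (Fin 3) K) : Matrix (Fin 3) (Fin 3) K) - 1) ^ 2)).restrictScalars 𝒪[K]) ≤ scaleLattice (ϖ ^ (2 * dep w + 1)) w.1 then 1 else 2)
    (hBD : D ≤ B)
    (GC : {M : Submodule 𝒪[K] (Fin 3 → K) // IsVertex σ ϖ ((StdForm.antidiagonal 3).over K) M} → Set {M : Submodule 𝒪[K] (Fin 3 → K) // IsVertex σ ϖ ((StdForm.antidiagonal 3).over K) M}) (hGC : ∀ v w, w ∈ GC v ↔ ∃ c, ((latticeGraph σ ϖ ((StdForm.antidiagonal 3).over K)).Adj v c ∧ (latticeGraph σ ϖ ((StdForm.antidiagonal 3).over K)).dist ⟨stdLattice K 3, 0, isSelfDualLattice_stdLattice_three_of_v hϖ⟩ c = (latticeGraph σ ϖ ((StdForm.antidiagonal 3).over K)).dist ⟨stdLattice K 3, 0, isSelfDualLattice_stdLattice_three_of_v hϖ⟩ v + 1 ∧ c ∈ {v | latticeGraphIso σ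 ϖ ((StdForm.antidiagonal 3).over K) γ v = v}) ∧
      ((latticeGraph σ ϖ ((StdForm.antidiagonal 3).over K)).Adj c w ∧ (latticeGraph σ ϖ ((StdForm.antidiagonal 3).over K)).dist ⟨stdLattice K 3, 0, isSelfDualLattice_stdLattice_three_of_v hϖ⟩ w = (latticeGraph σ ϖ ((StdForm.antidiagonal 3).over K)).dist ⟨stdLattice K 3, 0, isSelfDualLattice_stdLattice_three_of_v hϖ⟩ c + 1 ∧ w ∈ {v | latticeGraphIso σ ϖ ((StdForm.antidiagonal 3).over K) γ v = v}))
    (q : ℕ) (hq : q = Nat.card 𝓀[K])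
    (horient : ∀ v : {M : Submodule 𝒪[K] (Fin 3 → K) // IsVertex σ ϖ ((StdForm.antidiagonal 3).over K) M}, IsSelfDualLattice σ ϖ ((StdForm.antidiagonal 3).over K) v.1 → v ≠ ⟨stdLattice K 3, 0, isSelfDualLattice_stdLattice_three_of_v hϖ⟩ → latticeGraphIso σ ϖ ((StdForm.antidiagonal 3).over K) γ v = v → dep v < D →
      ∃ p g : {M : Submodule 𝒪[K] (Fin 3 → K) // IsVertex σ ϖ ((StdForm.antidiagonal 3).over K) M}, (latticeGraph σ ϖ ((StdForm.antidiagonal 3).over K)).Adj v p ∧ (latticeGraph σ ϖ ((StdForm.antidiagonal 3).over K)).dist ⟨stdLattice K 3, 0, isSelfDualLattice_stdLattice_three_of_v hϖ⟩ p + 1 = (latticeGraph σ ϖ ((StdForm.antidiagonal 3).over K)).dist ⟨stdLattice K 3, 0, isSelfDualLattice_stdLattice_three_of_v hϖ⟩ v ∧ (latticeGraph σ ϖ ((StdForm.antidiagonal 3).over K)).Adj p g ∧ g ≠ v ∧ g.1.map ((Matrix.toLin' (((γ : GL (Fin 3) K) : Matrix (Fin 3) (Fin 3) K) - 1)).restrictScalars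 𝒪[K]) ≤ scaleLattice (ϖ ^ dep v) g.1)
    (v : {M : Submodule 𝒪[K] (Fin 3 → K) // IsVertex σ ϖ ((StdForm.antidiagonal 3).over K) M}) (hvF : v ∈ {v : {M : Submodule 𝒪[K] (Fin 3 → K) // IsVertex σ ϖ ((StdForm.antidiagonal 3).over K) M} | latticeGraphIso σ ϖ ((StdForm.antidiagonal 3).over K) γ v = v}) (hv : IsSelfDualLattice σ ϖ ((StdForm.antidiagonal 3).over K) v.1) (hvr : v ≠ ⟨stdLattice K 3, 0, isSelfDualLattice_stdLattice_three_of_v hϖ⟩) (hvD : dep v < D) (hd1 : dep v = 1) (hrk2 : rk v = 2) :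
    (∀ w ∈ GC v, dep w = 0) ∧ (GC v).ncard = q := by
  have hfix : latticeGraphIso σ ϖ ((StdForm.antidiagonal 3).over K) γ v = v := hvF
  obtain ⟨p, g, hp, hpin, hg, hgv, hup⟩ := horient v hv hvr hfix hvD
  rw [hd1, pow_one] at hup
  have hlev := lev_pow_of_le_dep hdep hfix (le_of_eq hd1.symm)
  rw [pow_one] at hlev
  have hlev2 := not_lev_pow_of_dep_lt hdep hfix (show 2 ≤ B by omega) (by omega : dep v < 2)
  have hrk' := ((rk_eq_one_iff_of_hrk hrk v).2).1 hrk2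
  rw [hd1] at hrk'
  have hnil := lev₃_of_lev_of_eigenframe_of_le hϖ hγ0 A s hs1 hγA heD v (by omega : 1 + 1 ≤ D) (by rw [pow_one]; exact hlev)
  obtain ⟨hall, hcard⟩ := fixedGrandchildren_not_lev_and_ncard_of_regular_one hσ hvσ hσϖ hϖ hres h2 hT hγ0 hv hvr hfix hp hpin hg hgv hup hlev hlev2 hrk' hnil
  rw [gc_eq_rowSet hϖ GC hGC v, hq]
  refine ⟨fun w hw => ?_, hcard⟩
  have hwfix : latticeGraphIso σ ϖ ((StdForm.antidiagonal 3).over K) γ w = w := by obtain ⟨c, -, -, -, hwf⟩ := hw; exact hwf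
  have hn := hall w hw
  by_contra h0
  exact hn (by have := lev_pow_of_le_dep hdep hwfix (show 1 ≤ dep w by omega); rwa [pow_one] at this)

/-- **`hE`: an EVEN fixed self-dual vertex (depth `2m+2 < D`, rank `2`) has `q²` fixed grandchildren, all `(2m+1, rank 2)`** (★ ROW-E).
[cite: Kottwitz1986, §3] [cite: Rogawski1990, §4.9 pp. 54–56] -/
theorem engineRowGen_E (hσ : ∀ x, σ (σ x) = x) (hvσ : ∀ a, Valued.v (σ a) = Valued.v a) (hσϖ : σ ϖ = -ϖ)
    (hϖ : Valued.v ϖ = WithZero.exp (-1 : ℤ)) (hres : ∀ x : K, Valued.v x ≤ 1 → Valued.v (σ x - x) < 1) (h2 : Valued.v (2 : K) = 1) [Finite 𝓀[K]]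
    (hT : (latticeGraph σ ϖ ((StdForm.antidiagonal 3).over K)).IsTree)
    {γ : unitaryGroupOfForm σ ((StdForm.antidiagonal 3).over K)} (hγ0 : γ ∈ unitaryInt σ ((StdForm.antidiagonal 3).over K))
    (A : GL (Fin 3) K) (s : Fin 3 → K) (hs1 : s 1 = 1)
    (hγA : ((γ : GL (Fin 3) K) : Matrix (Fin 3) (Fin 3) K) = (A : Matrix (Fin 3) (Fin 3) K) * Matrix.diagonal s * ((A⁻¹ : GL (Fin 3) K) : Matrix (Fin 3) (Fin 3) K))
    {D : ℕ} (heD : ∀ i, Valued.v (s i - 1) ≤ Valued.v ϖ ^ D)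
    (B : ℕ) (dep rk : {M : Submodule 𝒪[K] (Fin 3 → K) // IsVertex σ ϖ ((StdForm.antidiagonal 3).over K) M} → ℕ)
    (hdep : ∀ w : {M : Submodule 𝒪[K] (Fin 3 → K) // IsVertex σ ϖ ((StdForm.antidiagonal 3).over K) M}, latticeGraphIso σ ϖ ((StdForm.antidiagonal 3).over K) γ w = w → ∀ e, e ≤ dep w ↔ e ≤ B ∧ w.1.map ((Matrix.toLin' (((γ : GL (Fin 3) K) : Matrix (Fin 3) (Fin 3) K) - 1)).restrictScalars 𝒪[K]) ≤ scaleLattice (ϖ ^ e) w.1)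
    (hrk : ∀ w : {M : Submodule 𝒪[K] (Fin 3 → K) // IsVertex σ ϖ ((StdForm.antidiagonal 3).over K) M}, rk w = if w.1.map ((Matrix.toLin' ((((γ : GL (Fin 3) K) : Matrix (Fin 3) (Fin 3) K) - 1) ^ 2)).restrictScalars 𝒪[K]) ≤ scaleLattice (ϖ ^ (2 * dep w + 1)) w.1 then 1 else 2)
    (hBD : D ≤ B)
    (GC : {M : Submodule 𝒪[K] (Fin 3 → K) // IsVertex σ ϖ ((StdForm.antidiagonal 3).over K) M} → Set {M : Submodule 𝒪[K] (Fin 3 → K) // IsVertex σ ϖ ((StdForm.antidiagonal 3).over K) M}) (hGC : ∀ v w, w ∈ GC v ↔ ∃ c, ((latticeGraph σ ϖ ((StdForm.antidiagonal 3).over K)).Adj v c ∧ (latticeGraph σ ϖ ((StdForm.antidiagonal 3).over K)).dist ⟨stdLattice K 3, 0, isSelfDualLattice_stdLattice_three_of_v hϖ⟩ c = (latticeGraph σ ϖ ((StdForm.antidiagonal 3).over K)).dist ⟨stdLattice K 3, 0, isSelfDualLattice_stdLattice_three_of_v hϖ⟩ v + 1 ∧ c ∈ {v | latticeGraphIso σ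 ϖ ((StdForm.antidiagonal 3).over K) γ v = v}) ∧
      ((latticeGraph σ ϖ ((StdForm.antidiagonal 3).over K)).Adj c w ∧ (latticeGraph σ ϖ ((StdForm.antidiagonal 3).over K)).dist ⟨stdLattice K 3, 0, isSelfDualLattice_stdLattice_three_of_v hϖ⟩ w = (latticeGraph σ ϖ ((StdForm.antidiagonal 3).over K)).dist ⟨stdLattice K 3, 0, isSelfDualLattice_stdLattice_three_of_v hϖ⟩ c + 1 ∧ w ∈ {v | latticeGraphIso σ ϖ ((StdForm.antidiagonal 3).over K) γ v = v}))
    (q : ℕ) (hq : q = Nat.card 𝓀[K])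
    (horient : ∀ v : {M : Submodule 𝒪[K] (Fin 3 → K) // IsVertex σ ϖ ((StdForm.antidiagonal 3).over K) M}, IsSelfDualLattice σ ϖ ((StdForm.antidiagonal 3).over K) v.1 → v ≠ ⟨stdLattice K 3, 0, isSelfDualLattice_stdLattice_three_of_v hϖ⟩ → latticeGraphIso σ ϖ ((StdForm.antidiagonal 3).over K) γ v = v → dep v < D →
      ∃ p g : {M : Submodule 𝒪[K] (Fin 3 → K) // IsVertex σ ϖ ((StdForm.antidiagonal 3).over K) M}, (latticeGraph σ ϖ ((StdForm.antidiagonal 3).over K)).Adj v p ∧ (latticeGraph σ ϖ ((StdForm.antidiagonal 3).over K)).dist ⟨stdLattice K 3, 0, isSelfDualLattice_stdLattice_three_of_v hϖ⟩ p + 1 = (latticeGraph σ ϖ ((StdForm.antidiagonal 3).over K)).dist ⟨stdLattice K 3, 0, isSelfDualLattice_stdLattice_three_of_v hϖ⟩ v ∧ (latticeGraph σ ϖ ((StdForm.antidiagonal 3).over K)).Adj p g ∧ g ≠ v ∧ g.1.map ((Matrix.toLin' (((γ : GL (Fin 3) K) : Matrix (Fin 3) (Fin 3) K) - 1)).restrictScalars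 𝒪[K]) ≤ scaleLattice (ϖ ^ dep v) g.1)
    (v : {M : Submodule 𝒪[K] (Fin 3 → K) // IsVertex σ ϖ ((StdForm.antidiagonal 3).over K) M}) (hvF : v ∈ {v : {M : Submodule 𝒪[K] (Fin 3 → K) // IsVertex σ ϖ ((StdForm.antidiagonal 3).over K) M} | latticeGraphIso σ ϖ ((StdForm.antidiagonal 3).over K) γ v = v}) (hv : IsSelfDualLattice σ ϖ ((StdForm.antidiagonal 3).over K) v.1) (hvr : v ≠ ⟨stdLattice K 3, 0, isSelfDualLattice_stdLattice_three_of_v hϖ⟩) (hvD : dep v < D) (m : ℕ) (hdm : dep v = 2 * m + 2) (hrk2 : rk v = 2) :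
    (∀ w ∈ GC v, dep w = 2 * m + 1 ∧ rk w = 2) ∧ (GC v).ncard = q ^ 2 := by
  have hfix : latticeGraphIso σ ϖ ((StdForm.antidiagonal 3).over K) γ v = v := hvF
  obtain ⟨p, g, hp, hpin, hg, hgv, hup⟩ := horient v hv hvr hfix hvD
  rw [hdm] at hup hvD
  have hlev := lev_pow_of_le_dep hdep hfix (le_of_eq hdm.symm)
  have hexact := not_lev_pow_of_dep_lt hdep hfix (show 2 * m + 2 + 1 ≤ B by omega) (by omega : dep v < 2 * m + 2 + 1)
  have hrk' := ((rk_eq_one_iff_of_hrk hrk v).2).1 hrk2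
  rw [hdm] at hrk'
  have hnil := lev₃_of_lev_of_eigenframe_of_le hϖ hγ0 A s hs1 hγA heD v (by omega : 2 * m + 2 + 1 ≤ D) hlev
  obtain ⟨hall, hcard⟩ := fixedGrandchildren_tokens_and_ncard_of_even hσ hvσ hσϖ hϖ hres h2 hT hγ0 hv hvr hfix (by omega : 2 ≤ 2 * m + 2) ⟨m + 1, by ring⟩
    hp hpin hg hgv hup hlev hexact hrk' hnil
  rw [gc_eq_rowSet hϖ GC hGC v, hq]
  refine ⟨fun w hw => ?_, hcard⟩
  have hwfix : latticeGraphIso σ ϖ ((StdForm.antidiagonal 3).over K) γ w = w := by obtain ⟨c, -, -, -, hwf⟩ := hw; exact hwf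
  obtain ⟨hw1, hw2, hw3⟩ := hall w hw
  rw [show 2 * m + 2 - 1 = 2 * m + 1 by omega] at hw1
  rw [show 2 * (2 * m + 2) - 1 = 2 * (2 * m + 1) + 1 by omega] at hw3
  have hdw : dep w = 2 * m + 1 := dep_eq_of_lev_of_not_lev hdep hwfix (by omega) hw1 hw2
  refine ⟨hdw, ((rk_eq_one_iff_of_hrk hrk w).2).2 ?_⟩
  rw [hdw]; exact hw3

end Literature.NumberTheory.Automorphic.UnitaryLatticeTree

end
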